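import Summits.PneNP.GCT.Conjectures.KYFlatteningBlindPaddedPerThree
import Summits.PneNP.GCT.Max.SF6PermanentSide
import Literature.Barriers.ValiantsHypothesis.PartialDerivativesDetPerm
import Literature.Computability.AlgebraicComplexity.PolynomialKoszulYoungFlatteningDuality
import HarnessLib
import HarnessLib.Audit

/-!
# `GCT/Max`: theory-2's padding-transport identity R-F-T2-25 for Koszul–Young ranks, TYPED (Lean proof deferred),
# and the PROVED reduction "R-F-T2-25 + the 9-letter KY tables ⇒ C-F-1 (`KYBlindPaddedPerThreeOwn`)"

Cell `pub-gct-max` (HOME `run/shared/lean/pub/pub-gct-max/`), track F; lead D101/D110 (a) (2026-08-23T05:42:59Z): "type the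
STATEMENT of R-F-T2-25 (+ the corollary) as a `def … : Prop` … docstring 'theorem (theory-2 R-F-T2-25), Lean proof deferred';
the 400–800-line Lean proof is NOT commissioned before K1"; lit-2's D110 (a) answer (HOME INBOX 2026-08-23, l.437): the typed
cell statements C-F-1-own / S / L6 of `Conjectures/KYFlatteningBlindPaddedPerThree.lean` are COROLLARIES of R-F-T2-25 + the
tree theorem `h_{per₃} = h_{det₃}` + ONE finite certified table (the cellwise dominance of the two 9-letter Koszul–Young tables
of `per₃`, `det₃`), with no conjectural residue. Placement: Literature refuses unpublished statements (gate lint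
`literature-cited-only`), so the statement is typed HERE, Summits-side under the naming rule `GCT/Max/`, as an obligation node
(`@[conjecture]` = "not yet a theorem of the tree"; on paper it IS a theorem of the cell, see below), exactly as the cell's other
typed statements. This file ASSERTS NOTHING beyond what it proves. HONEST FRAMING: multiplicity data and certified rank bounds at
small parameters; occurrence obstructions are ruled out in print (BIP'16) — multiplicity obstructions are the open door;
nothing here is a claim on VP vs VNP or P vs NP.

**R-F-T2-25 as written (theory-2, `HOME/flat/FLAT-PLAN.md` v3.3 §L.7, sha256/16 `fb158cc23c59f672`).** "THEOREM (paper-proved,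
§I.1 L3 (a)(b) + L3x; exact check below). Let f ∈ S^d V, N = dim V, h_f(j) = rank of the j-th catalecticant of f (h_f := 0
outside [0, d]), KY_{p,k}(f) = rank of the Koszul–Young flattening S^kV* ⊗ Λ^pV → S^{d−k−1}V ⊗ Λ^{p+1}V (tree: `kyRankFin`;
KY_{p′,k′}(f) := 0 unless 0 ≤ p′ ≤ N−1 and 0 ≤ k′ ≤ d−1). Then for every s ≥ 0, every 0 ≤ p ≤ N (ambient V ⊕ ℂy, dim N+1)
and every 0 ≤ k ≤ d+s−1:  KY_{p,k}(y^s·f) = KY_{p−1,k}(f) + KY_{p,k−s}(f) + C(N,p) · Σ_{t=0}^{s−1} h_f(k−t).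
s = 0 is engine-3's cone law L1; s = 1 is the padding law behind PADDED-n4 and PADDED-10var; the PF-17 tables (HIT at s = 1; s = 2:
204/204 cells; s = 3: 238/238) are instances. PROOF ROUTE: (1) apolar transport A_{y^s f} = A_f ⊗ ℂ[∂_y]/(∂_y^{s+1}); (2) L3:
KY_{p,k} is the rank of a Koszul differential of the apolar algebra; (3) Künneth + splitting of bounded complexes over a field
… Betti numbers never need to be computed. EXACT CHECK: calc6/l3x_transport_check.py … det₁, det₂, det₃, perm₃, det₄, perm₄ ×
s = 0..5: 36 (form, s) pairs, 2 163 cells, 0 mismatches." (Lead D110 (a): PF-17 re-booked 'reproduces a theorem'.) NOT IN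
PRINT as a packaged statement (theory-2 presearch §I.1/§L.7; the catalecticant half `h_{y^s f}(k) = Σ_{t≤s} h_f(k−t)` is the
block form of Landsberg 2017 Prop. 6.5.2.1's proof).

**Typing choices (faithful; ℕ-subtraction guarded).** Numbering-free ranks `kyRank ℂ p k` (tree); the padded form
`y^s·f := X none ^ s * rename some f` on the letters `Option σ` (`none = y`; this is literally how the tree's
`ownPaddedPerPoly` / the cell's `ownPaddedDetPoly` are defined, so the law applies to them by `rfl`); `h_f(j) :=` the tree's
`shiftedPartialsRank ℂ j 0 f` (= catalecticant rank, `shiftedPartialsRank_zero_eq`); `N = Fintype.card σ`; the three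
conventions "`:= 0` below the range" are explicit `if`-guards (`1 ≤ p`, `s ≤ k`, `t ≤ k`), while "`:= 0` above the range" needs
no guard because the tree's ranks ARE `0` there (`kyRankFin_eq_zero_of_isHomogeneous`, `kyRankFin_eq_zero_of_card_le` below,
and catalecticants of order `> d` vanish). Range exactly as printed: `p ≤ N`, `k + 1 ≤ d + s`, all `s`. Field: `ℂ` (the
cell's setting; the paper proof is over a field of characteristic `0`).

**What is PROVED here.** `kyRankFin_eq_zero_of_card_le` (`KY_{p,k} = 0` for `p ≥ #letters`), and the edge
`TransportImpliesBlindOwn : KYPaddingTransportLaw → KYCubicsDominance → KYBlindPaddedPerThreeOwn` (`_holds`): at `s = n−3`,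
`N = 9`, the `h`-sums for `per₃` and `det₃` agree by the TREE theorem `flatteningRank_perPoly_eq_detPoly` (Landsberg §6.3.2:
`h_{per_n} = h_{det_n}`), and the two remaining terms are dominated cellwise by `KYCubicsDominance`; out-of-range cells are
`0 ≤ _`. (The `n²`-letter statements S / L6 follow from the `s = 0` instance iterated `n²−10` times — Vandermonde bookkeeping —
not typed here.)

## References
* theory-2, FLAT-PLAN v3.3 §L.7 (R-F-T2-25), §I.1 (L3, L3x); engine-3 `HOME/flat/KY-CUBICS` (the two 9-letter tables, exact
  certificates: unimodular minors + 184/200 kernel vectors), `PREDICTIONS-F-1.md` (C-F-1).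
* [LandsbergGCT2017] §8.2.1 eq. (8.2.1) (the flattening), §6.3.2 (`h_{per_n} = h_{det_n}`), Prop. 6.5.2.1 (catalecticants of
  padded forms). [EfremenkoLandsbergSchenckWeyman2018] Conj. 1.2 (`ℓ^{n-m} perm_m` on its own letters).
-/

noncomputable section

open MvPolynomial

namespace Summit.PneNP.GCT

open Literature.Computability.AlgebraicComplexity Literature.Barriers.ValiantsHypothesis

/-! ## A generic vanishing lemma: no wedge index beyond the number of letters -/

/-- `KY_{p,k}(f) = 0` once `p ≥ q` = the number of letters: a `p`-subset `S ⊆ Fin q` is then all of `Fin q`, and the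
image of `∂^l ⊗ e_S` has no component `e_{S ⊔ {j}}`, `j ∉ S`. [folklore] -/
theorem kyRankFin_eq_zero_of_card_le {K : Type*} [Field K] {q : ℕ} (p k : ℕ) (f : MvPolynomial (Fin q) K)
    (hq : q ≤ p) : kyRankFin K p k f = 0 := by
  classical
  rw [kyRankFin]
  have hbot : Submodule.span K (kyImages p k f) = ⊥ := by
    rw [Submodule.span_eq_bot]
    rintro g ⟨l, S, -, hS, rfl⟩
    funext T
    refine kyImage_apply_eq_zero f l S T fun j hj _ => hj ?_
    have hle : S.card ≤ q := by simpa using Finset.card_le_univ S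
    have hSu : S = Finset.univ := Finset.eq_univ_of_card S (by rw [Fintype.card_fin]; omega)
    rw [hSu]
    exact Finset.mem_univ j
  rw [hbot, finrank_bot]

/-! ## The typed statements -/

/-- **R-F-T2-25 — theory-2's padding-transport identity for Koszul–Young ranks (THEOREM on paper, FLAT-PLAN v3.3 §L.7;
exact check 2 163 cells; Lean proof deferred per lead D110 (a); NOT in print):** for every form `f` of degree `d` in the
letters `σ` (`N = #σ`), every `s ≥ 0`, every `p ≤ N` and every `k` with `k + 1 ≤ d + s`,
`KY_{p,k}(y^s·f) = KY_{p−1,k}(f) + KY_{p,k−s}(f) + C(N,p)·Σ_{t<s} h_f(k−t)` over `ℂ`, where terms with a negative index are `0`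
(the `if`-guards) and `h_f(j)` is the rank of the `j`-th catalecticant. Typed as an obligation node of the cell because it
is not yet a theorem of the tree; `s = 0` is the cone law L1, `s = 1` the padding law. [folklore] -/
@[conjecture]
def KYPaddingTransportLaw : Prop :=
  ∀ (σ : Type) [Fintype σ] [DecidableEq σ] (f : MvPolynomial σ ℂ) (d : ℕ), f.IsHomogeneous d →
    ∀ s p k : ℕ, p ≤ Fintype.card σ → k + 1 ≤ d + s →
      kyRank ℂ p k (X none ^ s * rename some f) =
        (if 1 ≤ p then kyRank ℂ (p - 1) k f else 0) +
          (if s ≤ k then kyRank ℂ p (k - s) f else 0) +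
          (Fintype.card σ).choose p *
            ∑ t ∈ Finset.range s, (if t ≤ k then shiftedPartialsRank ℂ (k - t) 0 f else 0)

/-- **The 9-letter Koszul–Young tables: `per₃` is dominated by `det₃` cellwise** — for every `(p, k)`,
`rank KY_{p,k}(per₃) ≤ rank KY_{p,k}(det₃)` in `S³(ℂ⁹)` (engine-3 `HOME/flat/KY-CUBICS`: the two tables are EQUAL except at
`(p,k) = (4,1)`, where `det₃ − per₃ = 950 − 934 = 16`; certified exactly — unimodular minors and exact kernel vectors; cells
outside the table are `0 = 0`). A finite computation certified OUTSIDE Lean, not a published statement; an obligation node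
until the certificates are replayed in the kernel (e.g. via `kyRankFin_eq_rank_kyCoeffMatrix`). [folklore] -/
@[conjecture]
def KYCubicsDominance : Prop :=
  ∀ p k : ℕ, kyRank ℂ p k (perPoly (Fin 3) ℂ) ≤ kyRank ℂ p k (detPoly (Fin 3) ℂ)

/-- The implication **R-F-T2-25 ⇒ (9-letter dominance ⇒ C-F-1)** as a named statement (shape α: implications between the
cell's nodes are untagged `Prop`s with a `_holds` proof). [folklore] -/
def TransportImpliesBlindOwn : Prop :=
  KYPaddingTransportLaw → KYCubicsDominance → KYBlindPaddedPerThreeOwn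

/-- **R-F-T2-25 ⇒ (9-letter dominance ⇒ C-F-1) holds**: apply the identity at `s = n − 3` to `per₃` and `det₃`; the
catalecticant sums agree by the tree's `flatteningRank_perPoly_eq_detPoly` (`h_{per_n} = h_{det_n}`, Landsberg §6.3.2), the
two Koszul–Young terms are dominated cellwise; cells with `k ≥ n` or `p ≥ 10` are `0` on the left. [folklore] -/
theorem transportImpliesBlindOwn_holds : TransportImpliesBlindOwn := by
  intro hlaw hdom n hn p k
  by_cases hk : n ≤ k
  · have h0 : kyRank ℂ p k (ownPaddedPerPoly 3 n) = 0 := by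
      rw [kyRank_def]
      exact SF6PerSide.kyRankFin_eq_zero_of_isHomogeneous p k _
        ((ownPaddedPerPoly_isHomogeneous (by omega)).rename_isHomogeneous) hk
    rw [h0]; exact Nat.zero_le _
  by_cases hp : 10 ≤ p
  · have h0 : kyRank ℂ p k (ownPaddedPerPoly 3 n) = 0 := by
      rw [kyRank_def]
      exact kyRankFin_eq_zero_of_card_le p k _ (by simp; omega)
    rw [h0]; exact Nat.zero_le _
  have hper3 : (perPoly (Fin 3) ℂ).IsHomogeneous 3 := by
    simpa only [Fintype.card_fin] using (perPoly_isHomogeneous : (perPoly (Fin 3) ℂ).IsHomogeneous _)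
  have hdet3 : (detPoly (Fin 3) ℂ).IsHomogeneous 3 := by
    simpa only [Fintype.card_fin] using (detPoly_isHomogeneous : (detPoly (Fin 3) ℂ).IsHomogeneous _)
  have hcard : Fintype.card (Fin 3 × Fin 3) = 9 := by simp
  have hP := hlaw (Fin 3 × Fin 3) (perPoly (Fin 3) ℂ) 3 hper3 (n - 3) p k (by rw [hcard]; omega) (by omega)
  have hD := hlaw (Fin 3 × Fin 3) (detPoly (Fin 3) ℂ) 3 hdet3 (n - 3) p k (by rw [hcard]; omega) (by omega)
  change kyRank ℂ p k (X none ^ (n - 3) * rename some (perPoly (Fin 3) ℂ)) ≤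
    kyRank ℂ p k (X none ^ (n - 3) * rename some (detPoly (Fin 3) ℂ))
  rw [hP, hD]
  refine add_le_add (add_le_add ?_ ?_) (le_of_eq ?_)
  · split_ifs
    · exact hdom _ _
    · exact le_rfl
  · split_ifs
    · exact hdom _ _
    · exact le_rfl
  · refine congrArg _ (Finset.sum_congr rfl fun t _ => ?_)
    split_ifs
    · rw [flatteningRank_perPoly_eq_detPoly]
    · rfl

end Summit.PneNP.GCT
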